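import Mathlib
import Literature.Analysis.FluidPDE.Tao2016AveragedNS.ShiftSetCascadeFlows
import Literature.Analysis.FluidPDE.Tao2016AveragedNS.ShiftSetCascadeFlux
import Summits.NavierStokesRegularity.NavierStokesRegularity.Theorems.TaoLadderRungTwoFlatCertificateGlueReadoutCheckOn
import HarnessLib

/-!
# Certificate glue on a shift set `𝕊`, XXXV: THE LANDING CLAUSE `hland` FROM CHECKED LAYOUT-V BRANCH CHAINS — the section-sign tests on parallelepiped
  nodes (`sec < lev` before the readout window, `lev ≤ sec` after it), continuity of the section functional along window runs, and
  `hland_of_chainChecksV` = glue XXXI `hland_of_branchMeshes'` with every per-branch hypothesis read off Booleans (`checkStepV`, `checkSection`,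
  `checkReadout`, the sign tests, the clock tests) (helper for items stmt-NavierStokesRegularity-22987 `FlatGapCertificatesV2` (crux K_A♭ of route
  TaoLadderRungTwoFlat) and stmt-24295 K_A₂(64); cell harvest/h2-tao-ladder, p1 g16; g15 HANDOFF (c) «hland_of_chainChecks»)

HONEST FRAMING: Tao-type MODEL lattices (Tao 2016 §4/§6 vocabulary, shift-set parametrised); checker soundness — NO certificate instance exists in the
tree, nothing is certified here, no stub is closed, nothing here is a statement about the Navier–Stokes equations.
-/

-- the sub-problem namespace repeats the summit name by design (D-0017)
set_option linter.dupNamespace false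

namespace Summit.NavierStokesRegularity.NavierStokesRegularity.Theorems

open Set Finset Literature.Analysis.FluidPDE Literature.Analysis.FluidPDE.TaoCascade
open Summit.NavierStokesRegularity.NavierStokesRegularity.Theorems.TaylorModelCert

namespace CertificateGlueOn

variable {m : ℕ} {Kb Ka : ℤ}

/-! ### Continuity of the section functional along window runs -/

/-- The quadratic section functional of the weighted coordinates is continuous along every window run. [folklore] -/
theorem continuousOn_secQ_of_windowRun {𝕊 : Finset (ℤ × ℤ × ℤ)} {ε₀ : ℝ} {α : Fin m → Fin m → Fin m → ℤ × ℤ × ℤ → ℝ} {Eb Et : ℝ}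
    (hKb : 0 ≤ Kb) (hKa : 1 ≤ Ka) (ω : Fin m → ℤ → ℝ) (q : Fin (m * winLen Kb Ka) → ℝ) {s : ℝ} {S : Fin m → ℤ → ℝ → ℝ}
    (hrun : WindowRun 𝕊 ε₀ α Kb Ka Eb Et s S) :
    ContinuousOn (fun u => secQ q (pxcoord Kb Ka ω (slice S u))) (Icc 0 s) := by
  have hKK : 0 ≤ Ka + Kb + 1 := by omega
  unfold secQ
  refine continuousOn_const.mul (continuousOn_finsetSum _ fun c _ => continuousOn_const.mul ?_)
  refine ContinuousOn.pow ?_ 2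
  obtain ⟨h1, h2⟩ := shellAt_mem hKK (finProdFinEquiv.symm c).2
  have hc : ContinuousOn (S (finProdFinEquiv.symm c).1 (shellAt Kb (finProdFinEquiv.symm c).2)) (Icc 0 s) :=
    fun u hu => (hrun.deriv _ _ h1 h2 u hu).continuousWithinAt
  simpa [pxcoord, pwcoord, slice] using hc.div_const _

/-! ### The section sign on a parallelepiped node -/

/-- Rational `sec_q(x)`, `Σ_j |q_j x_j| w_j` and `½ Σ_j (±q_j)⁺ w_j²` bookkeeping: the UPPER section bound on the node hull `[x ± (ρ + E)]`. [folklore] -/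
def secUpperQ (n : ℕ) (qz : Array ℤ) (x ρ E : Array Dyad) : ℚ :=
  secQQ n qz x + (∑ j : Fin n, |((qz.getD j 0 : ℤ) : ℚ) * dyadToRat (dgetD x j)| * (dyadToRat (dgetD ρ j) + dyadToRat (dgetD E j))) +
    (1 / 2) * ∑ j : Fin n, max ((qz.getD j 0 : ℤ) : ℚ) 0 * (dyadToRat (dgetD ρ j) + dyadToRat (dgetD E j)) ^ 2

/-- The LOWER section bound on the node hull. [folklore] -/
def secLowerQ (n : ℕ) (qz : Array ℤ) (x ρ E : Array Dyad) : ℚ :=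
  secQQ n qz x - (∑ j : Fin n, |((qz.getD j 0 : ℤ) : ℚ) * dyadToRat (dgetD x j)| * (dyadToRat (dgetD ρ j) + dyadToRat (dgetD E j))) -
    (1 / 2) * ∑ j : Fin n, max (-((qz.getD j 0 : ℤ) : ℚ)) 0 * (dyadToRat (dgetD ρ j) + dyadToRat (dgetD E j)) ^ 2

/-- **The `sec < lev` test** on the node of a record (frame rows re-checked). [folklore] -/
def checkSecBelow (n : ℕ) (qz : Array ℤ) (s : VRec) (lev : ℚ) : Bool :=
  checkRowsLe n s.C s.r s.ρ && decide (secUpperQ n qz s.x s.ρ s.E < lev)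

/-- **The `lev ≤ sec` test** on the node of a record. [folklore] -/
def checkSecAbove (n : ℕ) (qz : Array ℤ) (s : VRec) (lev : ℚ) : Bool :=
  checkRowsLe n s.C s.r s.ρ && decide (lev ≤ secLowerQ n qz s.x s.ρ s.E)

/-- The section functional on the node hull lies between the two rational bounds. [folklore] -/
theorem secQ_mem_of_node {n : ℕ} (qz : Array ℤ) {xD ρD ED rD : Array Dyad} {C : Array (Array Dyad)} (hC : checkRowsLe n C rD ρD = true)
    {Y : Fin n → ℝ} (hY : ∃ ξ e : Fin n → ℝ, (∀ c, |ξ c| ≤ dvec (n := n) rD c) ∧ (∀ c, |e c| ≤ dvec (n := n) ED c) ∧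
      Y = dvec (n := n) xD + ((dmat (n := n) C).mulVec ξ + e)) :
    (secLowerQ n qz xD ρD ED : ℝ) ≤ secQ (qvec (n := n) qz) Y ∧ secQ (qvec (n := n) qz) Y ≤ (secUpperQ n qz xD ρD ED : ℝ) := by
  obtain ⟨ξ, e, hξ, he, hYe⟩ := hY
  set v := (dmat (n := n) C).mulVec ξ + e with hv
  have hw : ∀ j, |v j| ≤ dvec (n := n) ρD j + dvec (n := n) ED j := fun j => by
    simp only [hv, Pi.add_apply]
    exact (abs_add_le _ _).trans (add_le_add (mulVec_le_of_checkRowsLe hC ξ hξ j) (he j))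
  have hw0 : ∀ j, 0 ≤ dvec (n := n) ρD j + dvec (n := n) ED j := fun j => (abs_nonneg _).trans (hw j)
  rw [hYe, secQ_add]
  -- the linear part
  have hlin : |secPair (qvec (n := n) qz) (dvec (n := n) xD) v| ≤
      ∑ j, |qvec (n := n) qz j * dvec (n := n) xD j| * (dvec (n := n) ρD j + dvec (n := n) ED j) := by
    refine (abs_secPair_le _ _ _).trans (Finset.sum_le_sum fun j _ => ?_)
    exact mul_le_mul_of_nonneg_left (hw j) (abs_nonneg _)
  -- the quadratic part
  have hsq : ∀ j, v j ^ 2 ≤ (dvec (n := n) ρD j + dvec (n := n) ED j) ^ 2 := fun j => by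
    have h := hw j; nlinarith [abs_nonneg (v j), sq_abs (v j), hw0 j]
  have hup : ∑ j, qvec (n := n) qz j * v j ^ 2 ≤ ∑ j, max (qvec (n := n) qz j) 0 * (dvec (n := n) ρD j + dvec (n := n) ED j) ^ 2 :=
    Finset.sum_le_sum fun j _ => (mul_le_mul_of_nonneg_right (le_max_left _ _) (sq_nonneg _)).trans
      (mul_le_mul_of_nonneg_left (hsq j) (le_max_right _ _))
  have hlo : -(∑ j, max (-qvec (n := n) qz j) 0 * (dvec (n := n) ρD j + dvec (n := n) ED j) ^ 2) ≤ ∑ j, qvec (n := n) qz j * v j ^ 2 := by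
    rw [← Finset.sum_neg_distrib]
    refine Finset.sum_le_sum fun j _ => ?_
    have h1 : -(max (-qvec (n := n) qz j) 0) * v j ^ 2 ≤ qvec (n := n) qz j * v j ^ 2 :=
      mul_le_mul_of_nonneg_right (by have := le_max_left (-qvec (n := n) qz j) 0; linarith) (sq_nonneg _)
    have h2 : max (-qvec (n := n) qz j) 0 * v j ^ 2 ≤ max (-qvec (n := n) qz j) 0 * (dvec (n := n) ρD j + dvec (n := n) ED j) ^ 2 :=
      mul_le_mul_of_nonneg_left (hsq j) (le_max_right _ _)
    linarith
  have hU : (secUpperQ n qz xD ρD ED : ℝ) = secQ (qvec (n := n) qz) (dvec (n := n) xD) +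
      (∑ j, |qvec (n := n) qz j * dvec (n := n) xD j| * (dvec (n := n) ρD j + dvec (n := n) ED j)) +
      (1 / 2) * ∑ j, max (qvec (n := n) qz j) 0 * (dvec (n := n) ρD j + dvec (n := n) ED j) ^ 2 := by
    simp only [secUpperQ, secQQ, secQ, qvec, dvec]; push_cast; simp only [cast_dyadToRat]
  have hL : (secLowerQ n qz xD ρD ED : ℝ) = secQ (qvec (n := n) qz) (dvec (n := n) xD) -
      (∑ j, |qvec (n := n) qz j * dvec (n := n) xD j| * (dvec (n := n) ρD j + dvec (n := n) ED j)) -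
      (1 / 2) * ∑ j, max (-qvec (n := n) qz j) 0 * (dvec (n := n) ρD j + dvec (n := n) ED j) ^ 2 := by
    simp only [secLowerQ, secQQ, secQ, qvec, dvec]; push_cast; simp only [cast_dyadToRat]
  rw [hU, hL]
  have hl := abs_le.mp ((hlin.trans le_rfl))
  constructor <;> linarith [hl.1, hl.2]

/-- `sec < lev` on the node of record `j` from the test. [folklore] -/
theorem sec_lt_of_checkSecBelow {ωq : Fin m → ℤ → ℚ} {qz : Array ℤ} {rec : ℕ → VRec} {j : ℕ} {lev : ℚ}
    (h : checkSecBelow (m * winLen Kb Ka) qz (rec j) lev = true) {y : Fin m → ℤ → ℝ} (hy : nodeOfV Kb Ka ωq rec j y) :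
    secQ (qvec (n := m * winLen Kb Ka) qz) (pxcoord Kb Ka (fun i k => (ωq i k : ℝ)) y) < (lev : ℝ) := by
  simp only [checkSecBelow, Bool.and_eq_true, decide_eq_true_eq] at h
  have hb := (secQ_mem_of_node qz h.1 hy).2
  have : ((secUpperQ (m * winLen Kb Ka) qz (rec j).x (rec j).ρ (rec j).E : ℚ) : ℝ) < (lev : ℝ) := by exact_mod_cast h.2
  linarith

/-- `lev ≤ sec` on the node of record `j` from the test. [folklore] -/
theorem le_sec_of_checkSecAbove {ωq : Fin m → ℤ → ℚ} {qz : Array ℤ} {rec : ℕ → VRec} {j : ℕ} {lev : ℚ}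
    (h : checkSecAbove (m * winLen Kb Ka) qz (rec j) lev = true) {y : Fin m → ℤ → ℝ} (hy : nodeOfV Kb Ka ωq rec j y) :
    (lev : ℝ) ≤ secQ (qvec (n := m * winLen Kb Ka) qz) (pxcoord Kb Ka (fun i k => (ωq i k : ℝ)) y) := by
  simp only [checkSecAbove, Bool.and_eq_true, decide_eq_true_eq] at h
  have hb := (secQ_mem_of_node qz h.1 hy).1
  have : (lev : ℝ) ≤ ((secLowerQ (m * winLen Kb Ka) qz (rec j).x (rec j).ρ (rec j).E : ℚ) : ℝ) := by exact_mod_cast h.2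
  linarith

/-! ### The landing clause from checked branch chains -/

variable {ι : Type*} {Core : (Fin m → ℤ → ℝ) → Prop} {w : ℤ → ℚ} {r : ℚ}

/-- **THE LANDING CLAUSE `hland` FROM CHECKED LAYOUT-V BRANCH CHAINS.** Per branch `b`: records `rec b` with `checkStepV` for `j ≤ j₂ b`, readout steps
`j₁ b ≤ j ≤ j₂ b` each with a section record (`checkSection`) and readout constants (`checkReadout` on the tabulated section-node box), the sign tests
`checkSecBelow` at node `j₁ b` and `checkSecAbove` at node `j₂ b + 1`, the clocks `0 < Σ_{j<j₁} h` and `Σ_{j ≤ j₂} h ≤ c₀`, the identity start frame with a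
nonnegative remainder vector; globally `checkGlobal`; `Core (zstate zc)` for every readout reference state; and the fattened core covered by the weighted start
boxes ⇒ the clause `hland` of glue IV verbatim (`sec := secQ q ∘ pxcoord`, `w := wq`, `θ₀ := θn/θd`).
[cite: Tao2016AveragedNS, §6.3–6.4 Props. 6.4–6.5 (statement shape of a renormalisation certificate; the readout at the crossing); cell certificate format, landing checker] -/
theorem hland_of_chainChecksV (hKb : 0 ≤ Kb) (hKa : 1 ≤ Ka) {shifts : List (ℤ × ℤ × ℤ)} (hnd : shifts.Nodup)
    (h𝕊 : IsNearestNeighbourSet shifts.toFinset) {q : ℚ} (hq : 0 < 1 + (q : ℝ))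
    {αq : Fin m → Fin m → Fin m → ℤ × ℤ × ℤ → ℚ} {ωq : Fin m → ℤ → ℚ} (hω : ∀ i k, 0 < ωq i k)
    {prec p kexp nexp : ℕ} {Sp Sm : IntervalD} {bD : Dyad} {Eb Et lev c₀ : ℚ} {Mq : ℤ → ℚ}
    {rec : ι → ℕ → VRec} {j₁ j₂ : ι → ℕ} {sr : ι → ℕ → SecRec} {qz : Array ℤ}
    {i₀ : Fin m} {σ ρ Zx : ℚ} {θn θd : ℕ} {a : ι → ℕ → ℚ} {zc : ι → ℕ → Array Dyad}
    (hg : checkGlobal m Kb Ka prec shifts αq ωq q Sp Sm bD = true)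
    (hj : ∀ b, j₁ b ≤ j₂ b)
    (hs : ∀ b j, j < j₂ b + 1 → checkStepV m Kb Ka prec p kexp nexp shifts αq ωq Sp Sm bD Eb Et (rec b) j = true)
    (hsec : ∀ b j, j₁ b ≤ j → j ≤ j₂ b →
      checkSection m Kb Ka prec shifts (coefBoxOf prec αq ωq Sp Sm) qz (rec b j).lo (rec b j).hi (rec b j).δ (sr b j) = true)
    (hread : ∀ b j, j₁ b ≤ j → j ≤ j₂ b →
      checkReadout m Kb Ka ωq i₀ q σ (a b j) ρ r Zx Et θn θd w (zc b j) (xsArr (m * winLen Kb Ka) qz (sr b j) (rec b j).x lev)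
        (rsArr (m * winLen Kb Ka) qz (sr b j) (rec b j).E (rec b j).r (rec b j).C (rec b j).h) = true)
    (hcore : ∀ b j, j₁ b ≤ j → j ≤ j₂ b → Core (zstate (m := m) Kb Ka (zc b j)))
    (hbefore : ∀ b, checkSecBelow (m * winLen Kb Ka) qz (rec b (j₁ b)) lev = true)
    (hafter : ∀ b, checkSecAbove (m * winLen Kb Ka) qz (rec b (j₂ b + 1)) lev = true)
    (hpos : ∀ b, 0 < sumHV (rec b) (j₁ b)) (hc₀ : ∀ b, sumHV (rec b) (j₂ b + 1) ≤ c₀)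
    (hid : ∀ b, checkIdFrame (m * winLen Kb Ka) (rec b 0).C = true) (hE : ∀ b, checkNonneg (m * winLen Kb Ka) (rec b 0).E = true)
    (hcover : ∀ (z S₀ : Fin m → ℤ → ℝ), Core z → (∀ i k, -Kb ≤ k → k ≤ Ka → (w k : ℝ) * |S₀ i k - z i k| ≤ (r : ℝ)) →
      ∃ b, ∀ d, |pxcoord Kb Ka (fun i k => (ωq i k : ℝ)) S₀ d - dvec (n := m * winLen Kb Ka) (rec b 0).x d| ≤
        dvec (n := m * winLen Kb Ka) (rec b 0).r d) :
    ∀ (z : Fin m → ℤ → ℝ) (S : Fin m → ℤ → ℝ → ℝ), Core z →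
      (∀ i k, -Kb ≤ k → k ≤ Ka → (w k : ℝ) * |S i k 0 - z i k| ≤ (r : ℝ)) →
      (∀ i k, -Kb ≤ k → k ≤ Ka → ∀ u ∈ Icc 0 (c₀ : ℝ),
        HasDerivWithinAt (S i k) (quadTermOn shifts.toFinset (q : ℝ) (fun i₁ i₂ i μ => (αq i₁ i₂ i μ : ℝ)) S i k u) (Icc 0 (c₀ : ℝ)) u) →
      (∀ i, ContinuousOn (S i (-Kb - 1)) (Icc 0 (c₀ : ℝ))) → (∀ i, ContinuousOn (S i (Ka + 1)) (Icc 0 (c₀ : ℝ))) →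
      (∀ i, ∀ u ∈ Icc 0 (c₀ : ℝ), |S i (-Kb - 1) u| ≤ (Eb : ℝ)) →
      (∀ i, ∀ u ∈ Icc 0 (c₀ : ℝ), |S i (Ka + 1) u| ≤ (Et : ℝ)) →
      (∀ i k, -Kb ≤ k → k ≤ Ka → ∀ u ∈ Icc 0 (c₀ : ℝ), |S i k u| ≤ (Mq k : ℝ)) →
        ∃ (τ₁ a' : ℝ) (z' : Fin m → ℤ → ℝ), 0 < τ₁ ∧ τ₁ ≤ (c₀ : ℝ) ∧ 0 < a' ∧ (1 + (q : ℝ)) ^ (-((θn : ℝ) / (θd : ℝ))) ≤ a' ∧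
          (1 + (σ : ℝ)) * a' ≤ |S i₀ 1 τ₁| ∧ Core z' ∧
          (∀ i k, -Kb ≤ k → k + 1 ≤ Ka → (w k : ℝ) * |S i (1 + k) τ₁ / a' - z' i k| ≤ (ρ : ℝ) * (r : ℝ)) ∧
          (∀ (i : Fin m) (v : ℝ), |v| ≤ (Et : ℝ) → (w Ka : ℝ) * |v / a' - z' i Ka| ≤ (ρ : ℝ) * (r : ℝ)) ∧
          (∀ i, |S i (-Kb) τ₁| ≤ a' * (Zx : ℝ)) := by
  have hstep : ∀ b j, j < j₂ b + 1 → StepCert shifts.toFinset (q : ℝ) (fun i₁ i₂ i μ => (αq i₁ i₂ i μ : ℝ)) Kb Ka (Eb : ℝ) (Et : ℝ)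
      (fun k => (Mq k : ℝ)) (tOfV (rec b)) (nodeOfV Kb Ka ωq (rec b)) (hullOfV Kb Ka shifts αq ωq prec Sp Sm (rec b)) j :=
    fun b j hjb => stepCert_of_checkStepV hKb hKa hnd h𝕊 hω hg (hs b j hjb)
  have hmono : ∀ b j, j < j₂ b + 1 → tOfV (rec b) j < tOfV (rec b) (j + 1) := by
    intro b j hjb
    have h := hs b j hjb
    simp only [checkStepV, Bool.and_eq_true, decide_eq_true_eq] at h
    exact tOfV_lt_succ h.1.1.1.1.1.1.1.1.1.1.1.2
  have hpos' : ∀ b, 0 < tOfV (rec b) (j₁ b) := fun b => by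
    have : ((0 : ℚ) : ℝ) < ((sumHV (rec b) (j₁ b) : ℚ) : ℝ) := by exact_mod_cast hpos b
    have e : tOfV (rec b) (j₁ b) = ((sumHV (rec b) (j₁ b) : ℚ) : ℝ) := by simp [tOfV, sumHV]
    rw [e]; simpa using this
  have hc₀' : ∀ b, tOfV (rec b) (j₂ b + 1) ≤ (c₀ : ℝ) := fun b => by
    have e : tOfV (rec b) (j₂ b + 1) = ((sumHV (rec b) (j₂ b + 1) : ℚ) : ℝ) := by simp [tOfV, sumHV]
    rw [e]; exact_mod_cast hc₀ b
  have hread' : ∀ b j, j₁ b ≤ j → j ≤ j₂ b → StepRead shifts.toFinset (q : ℝ) (fun i₁ i₂ i μ => (αq i₁ i₂ i μ : ℝ)) Kb Ka (Eb : ℝ) (Et : ℝ)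
      (fun k => (Mq k : ℝ)) (tOfV (rec b)) (nodeOfV Kb Ka ωq (rec b))
      (fun y => secQ (qvec (n := m * winLen Kb Ka) qz) (pxcoord Kb Ka (fun i k => (ωq i k : ℝ)) y) = (lev : ℝ) →
        ∃ (a' : ℝ) (z' : Fin m → ℤ → ℝ), 0 < a' ∧ (1 + (q : ℝ)) ^ (-((θn : ℝ) / (θd : ℝ))) ≤ a' ∧
          (1 + (σ : ℝ)) * a' ≤ |y i₀ 1| ∧ Core z' ∧
          (∀ i k, -Kb ≤ k → k + 1 ≤ Ka → (w k : ℝ) * |y i (1 + k) / a' - z' i k| ≤ (ρ : ℝ) * (r : ℝ)) ∧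
          (∀ (i : Fin m) (v : ℝ), |v| ≤ (Et : ℝ) → (w Ka : ℝ) * |v / a' - z' i Ka| ≤ (ρ : ℝ) * (r : ℝ)) ∧
          (∀ i, |y i (-Kb)| ≤ a' * (Zx : ℝ))) j :=
    fun b j hj1 hj2 => stepRead_readout_of_checks hKb hKa hnd h𝕊 hq hω hg (hs b j (by omega)) (hsec b j hj1 hj2) (hread b j hj1 hj2)
      (hcore b j hj1 hj2)
  have key := hland_of_branchMeshes' (𝕊 := shifts.toFinset) (ε₀ := (q : ℝ)) (α := fun i₁ i₂ i μ => (αq i₁ i₂ i μ : ℝ)) (Kb := Kb) (Ka := Ka)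
    (Eb := (Eb : ℝ)) (Et := (Et : ℝ)) (M := fun k => (Mq k : ℝ)) (Core := Core) (w := fun k => (w k : ℝ)) (r := (r : ℝ))
    (Box := fun b S₀ => ∀ d, |pxcoord Kb Ka (fun i k => (ωq i k : ℝ)) S₀ d - dvec (n := m * winLen Kb Ka) (rec b 0).x d| ≤
      dvec (n := m * winLen Kb Ka) (rec b 0).r d)
    (t := fun b => tOfV (rec b)) (Node := fun b => nodeOfV Kb Ka ωq (rec b))
    (Hull := fun b => hullOfV Kb Ka shifts αq ωq prec Sp Sm (rec b)) (ρ := (ρ : ℝ)) (θ₀ := (θn : ℝ) / (θd : ℝ)) (σ := (σ : ℝ))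
    (c₀ := (c₀ : ℝ)) (Zx := (Zx : ℝ)) (i₀ := i₀)
    (sec := fun y => secQ (qvec (n := m * winLen Kb Ka) qz) (pxcoord Kb Ka (fun i k => (ωq i k : ℝ)) y)) (lev := (lev : ℝ))
    (j₁ := j₁) (j₂ := j₂) hcover hj (fun b => tOfV_zero (rec b)) hmono hpos' hc₀'
    (fun b y hy => node0_of_boxV (hid b) (hE b) hy) hstep
    (fun s S hrun => continuousOn_secQ_of_windowRun hKb hKa _ _ hrun)
    (fun b y hy => sec_lt_of_checkSecBelow (hbefore b) hy) (fun b y hy => le_sec_of_checkSecAbove (hafter b) hy) hread'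
  exact key

end CertificateGlueOn

end Summit.NavierStokesRegularity.NavierStokesRegularity.Theorems
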